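import Summits.AtomisticToContinuum.Crystallization.Theses.PalmUnimodularRigidity
import Summits.AtomisticToContinuum.Crystallization.Theorems.LayeredLawsSelectHcp.Negative.IntendedModel
import Summits.AtomisticToContinuum.Crystallization.Theorems.LayeredLawsSelectHcp.Negative.FccModel
import Summits.AtomisticToContinuum.Crystallization.Theorems.LayeredLawsSelectHcp.Negative.RootedRedundant
import Summits.AtomisticToContinuum.Crystallization.Theorems.ExcessDecayLiouvilleCoarseGrainsHcpEnergySeries
import Summits.AtomisticToContinuum.Crystallization.Theorems.PalmUnimodularRigidityCruxesToPalmRigidity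
import Summits.AtomisticToContinuum.Crystallization.Theorems.PalmUnimodularRigidityLayeredLawsSelectHcpDefs
import Summits.AtomisticToContinuum.Crystallization.Theorems.PalmUnimodularRigidityLayeredLawsSelectHcpLocalCongruence
import Summits.AtomisticToContinuum.Crystallization.Theorems.PalmUnimodularRigidityLayeredLawsSelectHcpRelaxedReference
import Summits.AtomisticToContinuum.Crystallization.Theorems.PalmUnimodularRigidityLayeredLawsSelectHcpSelectionNullCubic
import Summits.AtomisticToContinuum.Crystallization.Theorems.PalmUnimodularRigidityMinimiserShellsEquilibriumInLawGainEvent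
import Summits.AtomisticToContinuum.Crystallization.Theorems.OneCentreSteepnessLadderDominationEnergyLimitHcp
import Literature.Probability.Process.PointStationaryLaw

/-!
# Route `PalmUnimodularRigidity`, crux `LayeredLawsSelectHcp` (stmt-AtomisticToContinuum-9226):
# the ROUTE-LEVEL SPLIT into its two e*-free analytic cores (crux-strategist, D-0019 two-layer split)

`LayeredLawsSelectHcp_of_subs : SelectionFloor → HcpTubeRigidity → LayeredLawsSelectHcp`, sorry-free, where the two
sub-cruxes are EXACTLY the two remaining analytic cores of every registered line of the crux (lead memos c1 §5 /
c2: "PROMOTE"), written as self-contained statements over Mathlib + Literature (the route file cannot import the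
`Theorems/…Defs` vocabulary, which imports the route file itself):

* `SelectionFloor` — DENSITY-FORM HÄGG SELECTION ROBUST IN THE 1 % TUBE: for the relaxed hcp cell `(a₀,h₀)` (window
  `[189/200,199/200]×[77/100,163/200]` + global minimality of `e(hcp a h)` over the open quadrant, both landed:
  `stub_relaxedReference` p113318, uniqueness p116871) NO point-stationary LAYERED probability law (any Hägg word) with
  mean root energy `≤ e(hcp a₀ h₀)` charges the intrinsic event "the root is a cubic (faulted) site of its own bond
  graph" — the registered stub `stub_selectionFloor` of `Lines/mtp_prestress_split_ergodic_frame.lean` with `hcpE`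
  written as `(hcpPeriodicConfiguration _ _).energyPerParticle lennardJones` and `cubicRoot` unfolded (`Iff.rfl`
  read-backs below);
* `HcpTubeRigidity` — LAW-LEVEL STRICT LOCAL MINIMALITY OF RELAXED LJ HCP IN THE 1 % TUBE: for the same cell, every
  point-stationary HCP-CHARTED tube law with mean root energy `≤ e(hcp a₀ h₀)` has a.s. ZERO congruence defect of the
  root star — the registered `stub_hcpTubeRigidity` with its zero-stress hypothesis discharged (landed `stub_zeroStress`
  p91498) and `starDefect` unfolded.

The glue is the live skeleton's sorry-free composition, re-proved here over the landed modules only: H3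
`E_P[h] ≤ e* ≤ e(hcp a₀ h₀)` (`eStar_le`) puts a minimising law in both sublevel classes; `SelectionFloor` + the
landed potential-free back end `stub_haggSelection_nullCubicRoot` (p116671) make it hcp-charted; `HcpTubeRigidity`
gives zero defect a.s. at the root, the landed Aldous–Lyons transfer `ae_forall_map_sub_of_ae` at every atom, the
landed discrete Liouville theorem `stub_localCongruence` (p102411) the global congruence `S = A(hcpStacking a₀ h₀)`,
and the root energy of such a sample IS `e(hcp a₀ h₀)` (`rootEnergy_isometric_hcp`), whence `e(hcp a₀ h₀) = e*` —
AFTER the a.s. structure, no energy floor needed (Disproof mutation note). H1/`δ` unused (`crux_iff_without_rooted`).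
Disproof obligations honoured: both children keep an energy hypothesis (`layeredLawsSelectHcp_false_without_energy`,
`cubicRootNull_false_without_energy`), both use the crux's `−y` Mecke convention (`Negative.DiracLaws.PointStationary`),
neither compares Mecke signs or asserts a Bravais presentation of hcp. All `[folklore]`.
-/

noncomputable section

namespace Summit.AtomisticToContinuum.Crystallization.Cruxes.LayeredLawsSelectHcp.Split

open MeasureTheory Set
open Literature.MathematicalPhysics.StatisticalMechanics Literature.Geometry.DiscreteGeometry
open Literature.Probability.Process (map_sub_count_restrict count_restrict_singleton_ne_zero_iff)
open Summit.AtomisticToContinuum.Crystallization.Theses.PalmUnimodularRigidity (LayeredLawsSelectHcp)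
open Summit.AtomisticToContinuum.Crystallization.Theorems.ChargedEnergyGapNegative (eStar eStar_le)
open Summit.AtomisticToContinuum.Crystallization.Theorems.LayeredLawsSelectHcp.Negative.DiracLaws
  (Rooted PointStationary meanRootEnergy GoodShell BarlowLike Layered IsRelaxedHcp crux_iff)
open Summit.AtomisticToContinuum.Crystallization.Theorems.LayeredLawsSelectHcp.Negative.FccModel
  (set_eq_of_count_restrict_eq)
open Summit.AtomisticToContinuum.Crystallization.Theorems.LayeredLawsSelectHcp.Negative.RootedRedundant
  (rooted_of_pointStationary_layered crux_iff_without_rooted)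
open Summit.AtomisticToContinuum.Crystallization.Theorems.ExcessDecayLiouvilleCoarseGrains
  (hcpEnergySeries_of_eq)
open Summit.AtomisticToContinuum.Crystallization.Theorems.PalmUnimodularRigidity.LayeredLawsSelectHcp
  (hcpQ hcpE hcpSite hcpStarIdx refStar rootStar starDefect HcpCharted HcpLayered starDefect_nonneg
    cubicRoot stub_haggSelection_nullCubicRoot stub_relaxedReference stub_localCongruence)

/-- Euclidean `3`-space. [folklore] -/
local notation "E3" => EuclideanSpace ℝ (Fin 3)

/-! ## The two sub-cruxes (self-contained texts = the route file's child statements, byte for byte) -/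

/-- **Sub-crux 1 — `SelectionFloor`** (density-form Hägg selection robust in the 1 % tube; the selection core).
[folklore] -/
def SelectionFloor : Prop :=
  ∀ a₀ h₀ : ℝ, ∀ ha₀ : a₀ ≠ 0, ∀ hh₀ : h₀ ≠ 0, 189 / 200 ≤ a₀ → a₀ ≤ 199 / 200 → 77 / 100 ≤ h₀ → h₀ ≤ 163 / 200 → (∀ a h : ℝ, ∀ ha : a ≠ 0, ∀ hh : h ≠ 0, 0 < a → 0 < h → (Literature.MathematicalPhysics.StatisticalMechanics.hcpPeriodicConfiguration ha₀ hh₀).energyPerParticle Literature.MathematicalPhysics.StatisticalMechanics.lennardJones ≤ (Literature.MathematicalPhysics.StatisticalMechanics.hcpPeriodicConfiguration ha hh).energyPerParticle Literature.MathematicalPhysics.StatisticalMechanics.lennardJones) → ∀ P : MeasureTheory.Measure (MeasureTheory.Measure (EuclideanSpace ℝ (Fin 3))), MeasureTheory.IsProbabilityMeasure P → (∀ g : MeasureTheory.Measure (EuclideanSpace ℝ (Fin 3)) → EuclideanSpace ℝ (Fin 3) → ENNReal, Measurable (Function.uncurry g) → ∫⁻ μ, ∫⁻ y, g μ y ∂μ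 ∂P = ∫⁻ μ, ∫⁻ y, g (MeasureTheory.Measure.map (fun z => z - y) μ) (-y) ∂μ ∂P) → (∀ᵐ μ ∂P, ∃ S : Set (EuclideanSpace ℝ (Fin 3)), μ = (MeasureTheory.Measure.count : MeasureTheory.Measure (EuclideanSpace ℝ (Fin 3))).restrict S ∧ (∀ x ∈ S, (∃ a : ℝ, 9 / 10 ≤ a ∧ a ≤ 1 ∧ ∃ T : Finset (EuclideanSpace ℝ (Fin 3)), (↑T : Set (EuclideanSpace ℝ (Fin 3))) = (fun y : EuclideanSpace ℝ (Fin 3) => y - x) '' {y : EuclideanSpace ℝ (Fin 3) | y ∈ S ∧ y ≠ x ∧ dist y x ≤ 5 / 4 * a} ∧ (Literature.Geometry.DiscreteGeometry.ShellCloseTo (a / 100) T (Finset.image (fun v : EuclideanSpace ℝ (Fin 3) => a • v) Literature.Geometry.DiscreteGeometry.fccKissingPattern) ∨ Literature.Geometry.DiscreteGeometry.ShellCloseTo (a / 100) T (Finset.image (fun v : EuclideanSpace ℝ (Fin 3) => a • v) Literature.Geometry.DiscreteGeometry.hcpKissingPattern)))) ∧ (∃ s : ℤ → ℤ, Literature.MathematicalPhysics.StatisticalMechanics.IsHaggSeq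 s ∧ ∃ Φ : EuclideanSpace ℝ (Fin 3) → EuclideanSpace ℝ (Fin 3), Set.BijOn Φ (Literature.MathematicalPhysics.StatisticalMechanics.barlowStacking 1 (Real.sqrt (2 / 3)) s) S ∧ ∀ p ∈ Literature.MathematicalPhysics.StatisticalMechanics.barlowStacking 1 (Real.sqrt (2 / 3)) s, ∀ q ∈ Literature.MathematicalPhysics.StatisticalMechanics.barlowStacking 1 (Real.sqrt (2 / 3)) s, (dist p q = 1 ↔ (0 < dist (Φ p) (Φ q) ∧ dist (Φ p) (Φ q) ≤ 28 / 25)))) → (∫ μ, (∫ y, Literature.MathematicalPhysics.StatisticalMechanics.lennardJones ‖y‖ ∂μ) / 2 ∂P) ≤ (Literature.MathematicalPhysics.StatisticalMechanics.hcpPeriodicConfiguration ha₀ hh₀).energyPerParticle Literature.MathematicalPhysics.StatisticalMechanics.lennardJones → P {μ : MeasureTheory.Measure (EuclideanSpace ℝ (Fin 3)) | (0 : EuclideanSpace ℝ (Fin 3)) ∈ {y : EuclideanSpace ℝ (Fin 3) | μ {y} ≠ 0} ∧ ¬ (∃ p q t b : EuclideanSpace ℝ (Fin 3), t ≠ b ∧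 ((0 : EuclideanSpace ℝ (Fin 3)) ∈ {y : EuclideanSpace ℝ (Fin 3) | μ {y} ≠ 0} ∧ p ∈ {y : EuclideanSpace ℝ (Fin 3) | μ {y} ≠ 0} ∧ 0 < dist (0 : EuclideanSpace ℝ (Fin 3)) p ∧ dist (0 : EuclideanSpace ℝ (Fin 3)) p ≤ 28 / 25) ∧ ((0 : EuclideanSpace ℝ (Fin 3)) ∈ {y : EuclideanSpace ℝ (Fin 3) | μ {y} ≠ 0} ∧ q ∈ {y : EuclideanSpace ℝ (Fin 3) | μ {y} ≠ 0} ∧ 0 < dist (0 : EuclideanSpace ℝ (Fin 3)) q ∧ dist (0 : EuclideanSpace ℝ (Fin 3)) q ≤ 28 / 25) ∧ ((0 : EuclideanSpace ℝ (Fin 3)) ∈ {y : EuclideanSpace ℝ (Fin 3) | μ {y} ≠ 0} ∧ t ∈ {y : EuclideanSpace ℝ (Fin 3) | μ {y} ≠ 0} ∧ 0 < dist (0 : EuclideanSpace ℝ (Fin 3)) t ∧ dist (0 : EuclideanSpace ℝ (Fin 3)) t ≤ 28 / 25) ∧ ((0 : EuclideanSpace ℝ (Fin 3)) ∈ {y :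 EuclideanSpace ℝ (Fin 3) | μ {y} ≠ 0} ∧ b ∈ {y : EuclideanSpace ℝ (Fin 3) | μ {y} ≠ 0} ∧ 0 < dist (0 : EuclideanSpace ℝ (Fin 3)) b ∧ dist (0 : EuclideanSpace ℝ (Fin 3)) b ≤ 28 / 25) ∧ (p ∈ {y : EuclideanSpace ℝ (Fin 3) | μ {y} ≠ 0} ∧ q ∈ {y : EuclideanSpace ℝ (Fin 3) | μ {y} ≠ 0} ∧ 0 < dist p q ∧ dist p q ≤ 28 / 25) ∧ (t ∈ {y : EuclideanSpace ℝ (Fin 3) | μ {y} ≠ 0} ∧ p ∈ {y : EuclideanSpace ℝ (Fin 3) | μ {y} ≠ 0} ∧ 0 < dist t p ∧ dist t p ≤ 28 / 25) ∧ (t ∈ {y : EuclideanSpace ℝ (Fin 3) | μ {y} ≠ 0} ∧ q ∈ {y : EuclideanSpace ℝ (Fin 3) | μ {y} ≠ 0} ∧ 0 < dist t q ∧ dist t q ≤ 28 / 25) ∧ (b ∈ {y : EuclideanSpace ℝ (Fin 3) | μ {y} ≠ 0} ∧ p ∈ {y : EuclideanSpace ℝ (Fin 3) | μ {y} ≠ 0}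 ∧ 0 < dist b p ∧ dist b p ≤ 28 / 25) ∧ (b ∈ {y : EuclideanSpace ℝ (Fin 3) | μ {y} ≠ 0} ∧ q ∈ {y : EuclideanSpace ℝ (Fin 3) | μ {y} ≠ 0} ∧ 0 < dist b q ∧ dist b q ≤ 28 / 25))} = 0

/-- **Sub-crux 2 — `HcpTubeRigidity`** (law-level strict local minimality of relaxed LJ hcp in the 1 % tube; the
rigidity core). [folklore] -/
def HcpTubeRigidity : Prop :=
  ∀ a₀ h₀ : ℝ, ∀ ha₀ : a₀ ≠ 0, ∀ hh₀ : h₀ ≠ 0, 189 / 200 ≤ a₀ → a₀ ≤ 199 / 200 → 77 / 100 ≤ h₀ → h₀ ≤ 163 / 200 → (∀ a h : ℝ, ∀ ha : a ≠ 0, ∀ hh : h ≠ 0, 0 < a → 0 < h → (Literature.MathematicalPhysics.StatisticalMechanics.hcpPeriodicConfiguration ha₀ hh₀).energyPerParticle Literature.MathematicalPhysics.StatisticalMechanics.lennardJones ≤ (Literature.MathematicalPhysics.StatisticalMechanics.hcpPeriodicConfiguration ha hh).energyPerParticle Literature.MathematicalPhysics.StatisticalMechanics.lennardJones) → ∀ P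 : MeasureTheory.Measure (MeasureTheory.Measure (EuclideanSpace ℝ (Fin 3))), MeasureTheory.IsProbabilityMeasure P → (∀ g : MeasureTheory.Measure (EuclideanSpace ℝ (Fin 3)) → EuclideanSpace ℝ (Fin 3) → ENNReal, Measurable (Function.uncurry g) → ∫⁻ μ, ∫⁻ y, g μ y ∂μ ∂P = ∫⁻ μ, ∫⁻ y, g (MeasureTheory.Measure.map (fun z => z - y) μ) (-y) ∂μ ∂P) → (∀ᵐ μ ∂P, ∃ S : Set (EuclideanSpace ℝ (Fin 3)), μ = (MeasureTheory.Measure.count : MeasureTheory.Measure (EuclideanSpace ℝ (Fin 3))).restrict S ∧ (∀ x ∈ S, (∃ a : ℝ, 9 / 10 ≤ a ∧ a ≤ 1 ∧ ∃ T : Finset (EuclideanSpace ℝ (Fin 3)), (↑T : Set (EuclideanSpace ℝ (Fin 3))) = (fun y : EuclideanSpace ℝ (Fin 3) => y - x) '' {y : EuclideanSpace ℝ (Fin 3) | y ∈ S ∧ y ≠ x ∧ dist y x ≤ 5 / 4 * a} ∧ (Literature.Geometry.DiscreteGeometry.ShellCloseTo (a / 100) T (Finset.image (fun v : EuclideanSpace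 ℝ (Fin 3) => a • v) Literature.Geometry.DiscreteGeometry.fccKissingPattern) ∨ Literature.Geometry.DiscreteGeometry.ShellCloseTo (a / 100) T (Finset.image (fun v : EuclideanSpace ℝ (Fin 3) => a • v) Literature.Geometry.DiscreteGeometry.hcpKissingPattern)))) ∧ (∃ Φ : EuclideanSpace ℝ (Fin 3) → EuclideanSpace ℝ (Fin 3), Set.BijOn Φ (Literature.MathematicalPhysics.StatisticalMechanics.hcpStacking 1 (Real.sqrt (2 / 3))) S ∧ ∀ p ∈ Literature.MathematicalPhysics.StatisticalMechanics.hcpStacking 1 (Real.sqrt (2 / 3)), ∀ q ∈ Literature.MathematicalPhysics.StatisticalMechanics.hcpStacking 1 (Real.sqrt (2 / 3)), (dist p q = 1 ↔ (0 < dist (Φ p) (Φ q) ∧ dist (Φ p) (Φ q) ≤ 28 / 25)))) → (∫ μ, (∫ y, Literature.MathematicalPhysics.StatisticalMechanics.lennardJones ‖y‖ ∂μ) / 2 ∂P) ≤ (Literature.MathematicalPhysics.StatisticalMechanics.hcpPeriodicConfiguration ha₀ hh₀).energyPerParticle Literature.MathematicalPhysics.StatisticalMechanics.lennardJones → ∀ᵐ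 μ ∂P, (⨅ A : EuclideanSpace ℝ (Fin 3) ≃ₗᵢ[ℝ] EuclideanSpace ℝ (Fin 3), ∑ v ∈ ({(0, 1, 0), (0, -1, 0), (0, 0, 1), (0, 0, -1), (0, 1, -1), (0, -1, 1), (1, 0, 0), (1, -1, 0), (1, 0, -1), (-1, 0, 0), (-1, -1, 0), (-1, 0, -1)} : Finset (ℤ × ℤ × ℤ)), (Metric.infDist (A (Literature.MathematicalPhysics.StatisticalMechanics.barlowPos a₀ h₀ Literature.MathematicalPhysics.StatisticalMechanics.alternatingHagg v.1 v.2.1 v.2.2)) {y : EuclideanSpace ℝ (Fin 3) | μ {y} ≠ 0 ∧ 0 < ‖y‖ ∧ ‖y‖ ≤ 11 / 10}) ^ 2) = 0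

/-! ## Read-backs: the children ARE the registered stub shapes over the landed vocabulary (definitional) -/

/-- `SelectionFloor` unbundled over `PointStationary / Layered / meanRootEnergy / cubicRoot`. [folklore] -/
theorem selectionFloor_iff :
    SelectionFloor ↔
      ∀ a₀ h₀ : ℝ, ∀ ha₀ : a₀ ≠ 0, ∀ hh₀ : h₀ ≠ 0, 189 / 200 ≤ a₀ → a₀ ≤ 199 / 200 → 77 / 100 ≤ h₀ → h₀ ≤ 163 / 200 →
        (∀ a h : ℝ, ∀ ha : a ≠ 0, ∀ hh : h ≠ 0, 0 < a → 0 < h →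
          (hcpPeriodicConfiguration ha₀ hh₀).energyPerParticle lennardJones ≤
            (hcpPeriodicConfiguration ha hh).energyPerParticle lennardJones) →
        ∀ P : Measure (Measure E3), IsProbabilityMeasure P → PointStationary P → Layered P →
          meanRootEnergy P ≤ (hcpPeriodicConfiguration ha₀ hh₀).energyPerParticle lennardJones →
            P cubicRoot = 0 :=
  Iff.rfl

/-- `HcpTubeRigidity` unbundled over `PointStationary / HcpLayered / meanRootEnergy / starDefect`. [folklore] -/
theorem hcpTubeRigidity_iff :
    HcpTubeRigidity ↔
      ∀ a₀ h₀ : ℝ, ∀ ha₀ : a₀ ≠ 0, ∀ hh₀ : h₀ ≠ 0, 189 / 200 ≤ a₀ → a₀ ≤ 199 / 200 → 77 / 100 ≤ h₀ → h₀ ≤ 163 / 200 →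
        (∀ a h : ℝ, ∀ ha : a ≠ 0, ∀ hh : h ≠ 0, 0 < a → 0 < h →
          (hcpPeriodicConfiguration ha₀ hh₀).energyPerParticle lennardJones ≤
            (hcpPeriodicConfiguration ha hh).energyPerParticle lennardJones) →
        ∀ P : Measure (Measure E3), IsProbabilityMeasure P → PointStationary P → HcpLayered P →
          meanRootEnergy P ≤ (hcpPeriodicConfiguration ha₀ hh₀).energyPerParticle lennardJones →
            ∀ᵐ μ ∂P, starDefect a₀ h₀ μ = 0 :=
  Iff.rfl

/-! ## Landed inputs, restated in the form the glue consumes -/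

/-- `e(hcp a h) = hcpE a h` for `a, h ≠ 0` (third clause of the landed series theorem `hcpEnergySeries_of_eq`).
[folklore] -/
theorem hcpE_eq_energyPerParticle {a h : ℝ} (ha : a ≠ 0) (hh : h ≠ 0) :
    hcpE a h = (hcpPeriodicConfiguration ha hh).energyPerParticle lennardJones :=
  ((hcpEnergySeries_of_eq a h ha hh hcpQ rfl).2.2).symm

/-- The landed relaxed reference (`stub_relaxedReference`, p113318) in the `energyPerParticle` form the children
quantify over: a point of the window that minimises `e(hcp a h)` over the open quadrant. [folklore] -/
theorem relaxedReference_energy :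
    ∃ a₀ h₀ : ℝ, ∃ ha₀ : a₀ ≠ 0, ∃ hh₀ : h₀ ≠ 0,
      189 / 200 ≤ a₀ ∧ a₀ ≤ 199 / 200 ∧ 77 / 100 ≤ h₀ ∧ h₀ ≤ 163 / 200 ∧
      ∀ a h : ℝ, ∀ ha : a ≠ 0, ∀ hh : h ≠ 0, 0 < a → 0 < h →
        (hcpPeriodicConfiguration ha₀ hh₀).energyPerParticle lennardJones ≤
          (hcpPeriodicConfiguration ha hh).energyPerParticle lennardJones := by
  obtain ⟨a₀, h₀, ha₁, ha₂, hh₁, hh₂, hmin⟩ := stub_relaxedReference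
  have ha0 : 0 < a₀ := by linarith
  have hh0 : 0 < h₀ := by linarith
  refine ⟨a₀, h₀, ha0.ne', hh0.ne', ha₁, ha₂, hh₁, hh₂, fun a h ha hh hapos hhpos => ?_⟩
  rw [← hcpE_eq_energyPerParticle ha0.ne' hh0.ne', ← hcpE_eq_energyPerParticle ha hh]
  exact hmin a h hapos hhpos

/-- The hcp stacking is countable (image of `ℤ³`). [folklore] -/
theorem countable_hcpStacking (a h : ℝ) : (hcpStacking a h).Countable := by
  have hsub : hcpStacking a h ⊆
      Set.range (fun v : ℤ × ℤ × ℤ => barlowPos a h alternatingHagg v.1 v.2.1 v.2.2) := by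
    rintro x ⟨k, i, j, rfl⟩
    exact ⟨(k, i, j), rfl⟩
  exact (Set.countable_range _).mono hsub

/-- An hcp-charted set is Barlow-like (the crux's H4 global clause), with the alternating word. [folklore] -/
theorem hcpCharted_barlowLike {S : Set E3} (hS : HcpCharted S) : BarlowLike S :=
  ⟨alternatingHagg, isHaggSeq_alternating, hS⟩

/-- **The root energy of `count|A(hcpStacking a h)` is `e(hcp a h)`** (hard-core carrier, `a, h ≠ 0`):
`½∫ V_LJ(‖y‖) d(count|S) = ½∑'_{S} V_LJ(‖·‖) = ½∑'_{hcp} V_LJ(‖A ·‖) = ½∑'_{hcp} V_LJ(‖·‖) = e(hcp a h)`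
(landed: `integral_count_restrict`, `UniformlyDiscrete.summable_lennardJones`, `energyPerParticle_hcp_eq_half_tsum`).
[folklore] -/
theorem rootEnergy_isometric_hcp {a h : ℝ} (ha : a ≠ 0) (hh : h ≠ 0) {S : Set E3} (A : E3 ≃ₗᵢ[ℝ] E3)
    (hS : S = A '' hcpStacking a h) {δ : ℝ} (hδ : 0 < δ)
    (hsep : ∀ x ∈ S, ∀ y ∈ S, x ≠ y → δ ≤ dist x y) :
    (∫ y, lennardJones ‖y‖ ∂(Measure.count : Measure E3).restrict S) / 2 =
      (hcpPeriodicConfiguration ha hh).energyPerParticle lennardJones := by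
  have hud : Literature.MathematicalPhysics.StatisticalMechanics.UniformlyDiscrete S := ⟨δ, hδ, hsep⟩
  have hcount : S.Countable := by
    rw [hS]
    exact (countable_hcpStacking a h).image _
  have hsum : Summable fun z : S => lennardJones ‖(z : E3)‖ := by
    have h0 := hud.summable_lennardJones 0
    refine h0.congr fun z => ?_
    rw [dist_comm, dist_zero_right]
  have hmeas : Measurable fun z : E3 => lennardJones ‖z‖ :=
    Summit.AtomisticToContinuum.Crystallization.Theorems.PalmUnimodularRigidityMinimiserShells.EquilibriumInLaw.GainEvent.measurable_lennardJones.comp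
      measurable_norm
  rw [Summit.AtomisticToContinuum.Crystallization.Theorems.PalmUnimodularRigidityMinimiserShells.EquilibriumInLaw.GainEvent.integral_count_restrict
    hcount hmeas hsum]
  have hre : ∑' z : S, lennardJones ‖(z : E3)‖ =
      ∑' p : ↥(hcpStacking a h), lennardJones ‖(p : E3)‖ := by
    subst hS
    rw [← Equiv.tsum_eq (Equiv.Set.image (⇑A) (hcpStacking a h) A.injective)]
    refine tsum_congr fun p => ?_
    show lennardJones ‖A p‖ = lennardJones ‖(p : E3)‖
    rw [LinearIsometryEquiv.norm_map]
  rw [hre, Summit.AtomisticToContinuum.Crystallization.Theorems.DominationEnergyLimit.energyPerParticle_hcp_eq_half_tsum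
      ha hh lennardJones lennardJones_zero]
  ring

/-! ## The glue: the two cores imply the crux BY NAME (sorry-free) -/

/-- **The rigidity half from `HcpTubeRigidity`**: every minimising (`E_P[h] ≤ e*`) point-stationary hcp-layered
probability law is a.s. an exact rotated relaxed hcp crystal with `e(hcp a₀ h₀) = e*`.  Reference cell: landed;
sublevel: `e* ≤ e(hcp a₀ h₀)`; zero defect at the root: the child; at every atom: Aldous–Lyons (landed); global
congruence: discrete Liouville (landed); energy identity after the structure. [folklore] -/
theorem isRelaxedHcp_ae_of_hcpTubeRigidity (hR : HcpTubeRigidity) :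
    ∀ P : Measure (Measure E3), IsProbabilityMeasure P → PointStationary P →
      meanRootEnergy P ≤ eStar → HcpLayered P → ∀ᵐ μ ∂P, IsRelaxedHcp μ := by
  intro P hP hStat hEn hHcp
  have hHcp' : ∀ᵐ μ ∂P, ∃ S : Set E3, μ = (Measure.count : Measure E3).restrict S ∧
      (∀ x ∈ S, GoodShell S x) ∧ HcpCharted S := hHcp
  -- H1 comes for free: hcp-charted ⇒ layered ⇒ rooted (Negative.RootedRedundant)
  have hLay : Layered P := by
    show ∀ᵐ μ ∂P, ∃ S : Set E3, μ = (Measure.count : Measure E3).restrict S ∧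
      (∀ x ∈ S, GoodShell S x) ∧ BarlowLike S
    filter_upwards [hHcp'] with μ hμ
    obtain ⟨S, h1, h2, h3⟩ := hμ
    exact ⟨S, h1, h2, hcpCharted_barlowLike h3⟩
  have hRoot' : ∀ᵐ μ ∂P, ∃ S : Set E3, (0 : E3) ∈ S ∧
      (∀ x ∈ S, ∀ y ∈ S, x ≠ y → (891 / 1000 : ℝ) ≤ dist x y) ∧
      μ = (Measure.count : Measure E3).restrict S :=
    rooted_of_pointStationary_layered hStat hLay
  -- the relaxed reference cell, in energy form
  obtain ⟨a₀, h₀, ha0, hh0, ha₁, ha₂, hh₁, hh₂, hmin⟩ := relaxedReference_energy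
  have hstar : eStar ≤ (hcpPeriodicConfiguration ha0 hh0).energyPerParticle lennardJones := eStar_le _
  -- RIGIDITY (the child): zero congruence defect a.s. at the root
  have hWae : ∀ᵐ μ ∂P, starDefect a₀ h₀ μ = 0 :=
    (hcpTubeRigidity_iff.1 hR) a₀ h₀ ha0 hh0 ha₁ ha₂ hh₁ hh₂ hmin P hP hStat hHcp (hEn.trans hstar)
  -- … hence AT EVERY ATOM (Aldous–Lyons, landed): hard-core configurations are locally finite
  have hlocfin : ∀ᵐ μ ∂P, ∀ n : ℕ, μ ((fun z : E3 => ⌊‖z‖⌋₊) ⁻¹' {n}) < ⊤ := by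
    filter_upwards [hRoot'] with μ hμ
    obtain ⟨S, -, hsep, hμS⟩ := hμ
    intro n
    rw [hμS]
    exact Summit.AtomisticToContinuum.Crystallization.Theorems.PalmUnimodularRigidity.count_restrict_floorNorm_preimage_lt_top
      (by norm_num : (0 : ℝ) < 891 / 1000) hsep n
  have hWevery : ∀ᵐ μ ∂P, ∀ y : E3, μ {y} ≠ 0 →
      Measure.map (fun z => z - y) μ ∈ {ν : Measure E3 | starDefect a₀ h₀ ν = 0} :=
    Summit.AtomisticToContinuum.Crystallization.Theorems.PalmUnimodularRigidity.ae_forall_map_sub_of_ae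
      hStat hlocfin hWae
  -- DISCRETE LIOUVILLE (landed) sample by sample: the a.s. STRUCTURE, with the hard core kept
  have hstruct : ∀ᵐ μ ∂P, ∃ S : Set E3, μ = (Measure.count : Measure E3).restrict S ∧
      (∀ x ∈ S, ∀ y ∈ S, x ≠ y → (891 / 1000 : ℝ) ≤ dist x y) ∧
      ∃ A : E3 ≃ₗᵢ[ℝ] E3, S = A '' hcpStacking a₀ h₀ := by
    filter_upwards [hRoot', hHcp', hWevery] with μ hR hH hW
    obtain ⟨S', h0', hsep', hμ'⟩ := hR
    obtain ⟨S, hμ, hgood, hch⟩ := hH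
    have hSS' : S = S' := set_eq_of_count_restrict_eq (hμ.symm.trans hμ')
    have h0 : (0 : E3) ∈ S := by
      rw [hSS']
      exact h0'
    have hWx : ∀ x ∈ S, starDefect a₀ h₀
        ((Measure.count : Measure E3).restrict ((fun z : E3 => z - x) '' S)) = 0 := by
      intro x hx
      have hx' : μ {x} ≠ 0 := by
        rw [hμ]
        exact (count_restrict_singleton_ne_zero_iff S x).2 hx
      have h : starDefect a₀ h₀ (Measure.map (fun z : E3 => z - x) μ) = 0 := hW x hx'
      rw [hμ, map_sub_count_restrict] at h
      exact h
    obtain ⟨A, hA⟩ := stub_localCongruence a₀ h₀ ha₁ ha₂ hh₁ hh₂ S h0 hgood hch hWx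
    refine ⟨S, hμ, ?_, A, hA⟩
    rw [hSS']
    exact hsep'
  -- THE ENERGY IDENTITY, AFTER the structure: every sample is an isometric copy of `hcp(a₀,h₀)`, whose root
  -- energy IS `e(hcp a₀ h₀)`; so `E_P[h] = e(hcp a₀ h₀) ≤ e* ≤ e(hcp a₀ h₀)`.
  have hroot_ae : ∀ᵐ μ ∂P, (∫ y, lennardJones ‖y‖ ∂μ) / 2 =
      (hcpPeriodicConfiguration ha0 hh0).energyPerParticle lennardJones := by
    filter_upwards [hstruct] with μ hμ
    obtain ⟨S, hμS, hsep, A, hA⟩ := hμ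
    rw [hμS]
    exact rootEnergy_isometric_hcp ha0 hh0 A hA (by norm_num) hsep
  have hmean : meanRootEnergy P = (hcpPeriodicConfiguration ha0 hh0).energyPerParticle lennardJones := by
    show ∫ μ, (∫ y, lennardJones ‖y‖ ∂μ) / 2 ∂P = _
    rw [integral_congr_ae hroot_ae, integral_const, smul_eq_mul]
    simp
  have henergy : (hcpPeriodicConfiguration ha0 hh0).energyPerParticle lennardJones = eStar :=
    le_antisymm (hmean.symm.le.trans hEn) hstar
  -- CONCLUDE
  filter_upwards [hstruct] with μ hμ
  obtain ⟨S, hμS, -, A, hA⟩ := hμ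
  refine ⟨a₀, h₀, ha0, hh0, by linarith, by linarith, by linarith, by linarith, A, henergy, ?_⟩
  rw [hμS, hA]

/-- **The selection half from `SelectionFloor`**: a minimising point-stationary layered law is a.s. hcp-charted —
the child nulls the cubic-root density in the sublevel class `E_P[h] ≤ e* ≤ e(hcp a₀ h₀)`, and the LANDED
potential-free back end `stub_haggSelection_nullCubicRoot` (Palm transfer + Hägg-word combinatorics) reads off the
hcp chart. [folklore] -/
theorem hcpLayered_of_selectionFloor (hS : SelectionFloor) :
    ∀ P : Measure (Measure E3), IsProbabilityMeasure P → PointStationary P →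
      meanRootEnergy P ≤ eStar → Layered P → HcpLayered P := by
  intro P hP hStat hEn hLay
  obtain ⟨a₀, h₀, ha0, hh0, ha₁, ha₂, hh₁, hh₂, hmin⟩ := relaxedReference_energy
  have hstar : eStar ≤ (hcpPeriodicConfiguration ha0 hh0).energyPerParticle lennardJones := eStar_le _
  have hnull : P cubicRoot = 0 :=
    (selectionFloor_iff.1 hS) a₀ h₀ ha0 hh0 ha₁ ha₂ hh₁ hh₂ hmin P hP hStat hLay (hEn.trans hstar)
  exact stub_haggSelection_nullCubicRoot P hP hStat hLay hnull

/-- **`LayeredLawsSelectHcp_of_subs` — the route-level split is sound**: the two e*-free analytic cores imply the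
crux `Summit.AtomisticToContinuum.Crystallization.Theses.PalmUnimodularRigidity.LayeredLawsSelectHcp` BY NAME
(`crux_iff_without_rooted`: H1 and `δ` are never used). [folklore] -/
theorem LayeredLawsSelectHcp_of_subs : SelectionFloor → HcpTubeRigidity → LayeredLawsSelectHcp :=
  fun hS hR => crux_iff_without_rooted.2 fun P hP hStat hEn hLay =>
    isRelaxedHcp_ae_of_hcpTubeRigidity hR P hP hStat hEn (hcpLayered_of_selectionFloor hS P hP hStat hEn hLay)

end Summit.AtomisticToContinuum.Crystallization.Cruxes.LayeredLawsSelectHcp.Split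

end
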